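import Literature.FieldTheory.AlgClosed.AutFixedSubfield
import Mathlib.LinearAlgebra.Basis.VectorSpace
import Mathlib.LinearAlgebra.DirectSum.Finsupp
import Mathlib.RingTheory.TensorProduct.Maps
import HarnessLib

/-!
# Descent of `Aut(ℂ/F)`-stable subspaces and separation of tensors by conjugate embeddings

Topic `FieldTheory/AlgClosed`; a proofs-only sequel (theorems only, no definitions, no named
facts) of `AutFixedSubfield.lean` (the fixed field of `Aut(ℂ/F)` is `F` for a countable subfield
`F ⊆ ℂ`, `Complex.exists_ringEquiv_fix_apply_ne`).  Three standard consequences of "enough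
automorphisms", used in Galois-descent arguments over `ℂ` with an infinite, non-algebraic group
(Weil's `k`-closed sets, Lang, *Introduction to Algebraic Geometry*, III §5; Borel, *Linear
algebraic groups*, AG §14 "`k`-structures on vector spaces"):

* `Complex.submodule_le_span_fixed_of_forall_ringEquiv` — **an `Aut(ℂ/F)`-stable `ℂ`-subspace of
  `ℂⁿ` is spanned by its vectors with coordinates in `F`** (`F ⊆ ℂ` countable): the `F`-structure
  `Fⁿ ⊆ ℂⁿ` descends stable subspaces.  Proof by induction on the size of the support of a vector
  `v ∈ V`: normalise one coordinate to `1`; if some coordinate `v_j ∉ F`, an automorphism `ρ`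
  fixing `F` and moving `v_j` gives `w = v - ρv ∈ V` and `u = v - (v_j / w_j) w ∈ V` of smaller
  support with `v ∈ ℂu + ℂw`.
* `Complex.eq_zero_of_forall_sum_algEquiv_mul_eq_zero` — **conjugates of a `K`-linearly
  independent family `(bᵢ)` of complex numbers satisfy no universal linear relation**: if
  `Σ τ(bᵢ) xᵢ = 0` for every `τ ∈ Aut_K(ℂ)` (`K` a countable field, `ℂ` a `K`-algebra), then
  `x = 0` (the vectors `x` with this property form a stable subspace, whose `K`-rational vectors
  are `K`-linear relations among the `bᵢ`).
* `Complex.eq_zero_of_forall_productMap_algEquiv_eq_zero` — **the conjugates of the identity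
  embedding separate `ℂ ⊗_K ℂ`**: an element `h ∈ ℂ ⊗_K ℂ` killed by every multiplication map
  `x ⊗ c ↦ τ(x) c`, `τ ∈ Aut_K(ℂ)`, is zero (write `h = Σ bᵢ ⊗ cᵢ` on a `K`-basis of `ℂ`).

## References

* S. Lang, *Algebra*, rev. 3rd ed. (2002), Ch. VIII §1 (automorphisms of `ℂ`). [Lang2002]
* A. Borel, *Linear Algebraic Groups*, 2nd ed. (1991), AG §14.1–14.2 (`k`-structures, Galois
  descent of subspaces). [Borel1991]
-/

noncomputable section

open Cardinal TensorProduct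

namespace Literature.FieldTheory.AlgClosed

/-! ### Stable subspaces of `ℂⁿ` descend -/

/-- **An `Aut(ℂ/F)`-stable subspace of `ℂⁿ` is spanned by vectors with coordinates in `F`**
(`F ⊆ ℂ` a countable subfield): if `V ⊆ ℂ^ι` (`ι` finite) is a `ℂ`-subspace such that
`ρ ∘ v ∈ V` for every `v ∈ V` and every automorphism `ρ` of `ℂ` fixing `F` pointwise, then every
`v ∈ V` is a `ℂ`-linear combination of vectors `w ∈ V` all of whose coordinates lie in `F`.
[cite: Borel1991, AG §14.2] -/
theorem Complex.submodule_le_span_fixed_of_forall_ringEquiv {ι : Type*} [Fintype ι]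
    (F : Subfield ℂ) (hF : #F ≤ ℵ₀) (V : Submodule ℂ (ι → ℂ))
    (hV : ∀ ρ : ℂ ≃+* ℂ, (∀ x ∈ F, ρ x = x) → ∀ v ∈ V, (⇑ρ ∘ v) ∈ V) :
    V ≤ Submodule.span ℂ {w : ι → ℂ | w ∈ V ∧ ∀ i, w i ∈ F} := by
  classical
  set T := Submodule.span ℂ {w : ι → ℂ | w ∈ V ∧ ∀ i, w i ∈ F} with hT
  -- induction on the size of the support
  suffices h : ∀ (n : ℕ) (v : ι → ℂ), v ∈ V →
      (Finset.univ.filter fun i => v i ≠ 0).card ≤ n → v ∈ T from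
    fun v hv => h _ v hv le_rfl
  intro n
  induction n with
  | zero =>
    intro v hv hcard
    have hv0 : v = 0 := by
      funext i
      rw [Pi.zero_apply]
      by_contra hi
      have hmem : i ∈ Finset.univ.filter fun i => v i ≠ 0 := by simpa using hi
      rw [Nat.le_zero, Finset.card_eq_zero] at hcard
      simp [hcard] at hmem
    rw [hv0]
    exact T.zero_mem
  | succ n ih =>
    intro v hv hcard
    by_cases hall : ∀ i, v i ∈ F
    · exact Submodule.subset_span ⟨hv, hall⟩
    obtain ⟨i₀, hi₀⟩ := not_forall.1 hall
    have hvi₀ : v i₀ ≠ 0 := fun h => hi₀ (h ▸ F.zero_mem)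
    -- normalise the `i₀`-th coordinate to `1`
    set v' : ι → ℂ := (v i₀)⁻¹ • v with hv'
    have hv'V : v' ∈ V := V.smul_mem _ hv
    have hv'i₀ : v' i₀ = 1 := by simp [hv', hvi₀]
    have hsupp' : ∀ i, v' i ≠ 0 ↔ v i ≠ 0 := fun i => by simp [hv', hvi₀]
    have hvv' : v = (v i₀) • v' := by
      simp [hv', smul_smul, hvi₀]
    suffices hv'T : v' ∈ T by rw [hvv']; exact T.smul_mem _ hv'T
    have hcard' : (Finset.univ.filter fun i => v' i ≠ 0).card ≤ n + 1 := by
      have he : (Finset.univ.filter fun i => v' i ≠ 0) =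
          (Finset.univ.filter fun i => v i ≠ 0) := by
        ext i
        simp only [Finset.mem_filter, Finset.mem_univ, true_and]
        exact hsupp' i
      rw [he]
      exact hcard
    by_cases hall' : ∀ i, v' i ∈ F
    · exact Submodule.subset_span ⟨hv'V, hall'⟩
    obtain ⟨j, hj⟩ := not_forall.1 hall'
    have hv'j : v' j ≠ 0 := fun h => hj (h ▸ F.zero_mem)
    -- an automorphism fixing `F` and moving `v' j`
    obtain ⟨ρ, hρF, hρj⟩ := Complex.exists_ringEquiv_fix_apply_ne F hF hj
    set w : ι → ℂ := v' - ⇑ρ ∘ v' with hw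
    have hwV : w ∈ V := V.sub_mem hv'V (hV ρ hρF v' hv'V)
    have hwi₀ : w i₀ = 0 := by simp [hw, hv'i₀]
    have hwj : w j ≠ 0 := by
      simp only [hw, Pi.sub_apply, Function.comp_apply]
      exact fun h => hρj (sub_eq_zero.1 h).symm
    have hw_supp : ∀ i, v' i = 0 → w i = 0 := fun i hi => by simp [hw, hi]
    set u : ι → ℂ := v' - (v' j / w j) • w with hu
    have huV : u ∈ V := V.sub_mem hv'V (V.smul_mem _ hwV)
    have huj : u j = 0 := by
      simp only [hu, Pi.sub_apply, Pi.smul_apply, smul_eq_mul]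
      rw [div_mul_cancel₀ _ hwj, sub_self]
    have hu_supp : ∀ i, v' i = 0 → u i = 0 := fun i hi => by simp [hu, hi, hw_supp i hi]
    -- supports shrink
    have hwcard : (Finset.univ.filter fun i => w i ≠ 0).card ≤ n := by
      have hsub : (Finset.univ.filter fun i => w i ≠ 0) ⊆
          (Finset.univ.filter fun i => v' i ≠ 0).erase i₀ := by
        intro i hi
        simp only [Finset.mem_filter, Finset.mem_univ, true_and] at hi
        rw [Finset.mem_erase]
        refine ⟨?_, ?_⟩
        · rintro rfl
          exact hi hwi₀
        · simp only [Finset.mem_filter, Finset.mem_univ, true_and]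
          exact fun h => hi (hw_supp i h)
      have h1 := Finset.card_le_card hsub
      have hmem : i₀ ∈ Finset.univ.filter fun i => v' i ≠ 0 := by simp [hv'i₀]
      rw [Finset.card_erase_of_mem hmem] at h1
      omega
    have hucard : (Finset.univ.filter fun i => u i ≠ 0).card ≤ n := by
      have hsub : (Finset.univ.filter fun i => u i ≠ 0) ⊆
          (Finset.univ.filter fun i => v' i ≠ 0).erase j := by
        intro i hi
        simp only [Finset.mem_filter, Finset.mem_univ, true_and] at hi
        rw [Finset.mem_erase]
        refine ⟨?_, ?_⟩
        · rintro rfl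
          exact hi huj
        · simp only [Finset.mem_filter, Finset.mem_univ, true_and]
          exact fun h => hi (hu_supp i h)
      have h1 := Finset.card_le_card hsub
      have hmem : j ∈ Finset.univ.filter fun i => v' i ≠ 0 := by simp [hv'j]
      rw [Finset.card_erase_of_mem hmem] at h1
      omega
    have hwT := ih w hwV hwcard
    have huT := ih u huV hucard
    have hv'eq : v' = u + (v' j / w j) • w := by simp [hu]
    rw [hv'eq]
    exact T.add_mem huT (T.smul_mem _ hwT)

/-! ### Conjugate embeddings separate linearly independent families -/

/-- **Conjugates of a `K`-linearly independent family satisfy no universal `ℂ`-linear relation.**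
Let `ℂ` be an algebra over a countable field `K`, `b : ι → ℂ` (`ι` finite) a `K`-linearly
independent family and `x : ι → ℂ`. If `Σᵢ τ(bᵢ) xᵢ = 0` for EVERY `τ ∈ Aut_K(ℂ)`, then `x = 0`:
the vectors `x` with this property form an `Aut(ℂ/K)`-stable subspace of `ℂ^ι`, spanned by its
`K`-rational vectors (`Complex.submodule_le_span_fixed_of_forall_ringEquiv`), which are `K`-linear
relations among the `bᵢ` (take `τ = 1`) — there are none. [folklore] -/
theorem Complex.eq_zero_of_forall_sum_algEquiv_mul_eq_zero {K : Type} [Field K] [Algebra K ℂ]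
    (hK : #K ≤ ℵ₀) {ι : Type*} [Fintype ι] {b : ι → ℂ} (hb : LinearIndependent K b)
    {x : ι → ℂ} (hx : ∀ τ : ℂ ≃ₐ[K] ℂ, ∑ i, τ (b i) * x i = 0) : x = 0 := by
  classical
  -- the countable subfield `F = K · 1 ⊆ ℂ`
  set F : Subfield ℂ := (algebraMap K ℂ).fieldRange with hFdef
  have hF : #F ≤ ℵ₀ :=
    (Cardinal.mk_le_of_surjective (algebraMap K ℂ).rangeRestrictFieldEquiv.surjective).trans hK
  have hmemF : ∀ {y : ℂ}, y ∈ F ↔ ∃ k : K, algebraMap K ℂ k = y := fun {y} => RingHom.mem_fieldRange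
  -- the stable subspace of coefficient vectors
  let Φ : (ℂ ≃ₐ[K] ℂ) → ((ι → ℂ) →ₗ[ℂ] ℂ) := fun τ =>
    ∑ i : ι, (τ (b i)) • (LinearMap.proj i : (ι → ℂ) →ₗ[ℂ] ℂ)
  have hΦ : ∀ (τ : ℂ ≃ₐ[K] ℂ) (c : ι → ℂ), Φ τ c = ∑ i : ι, τ (b i) * c i := by
    intro τ c
    simp [Φ, LinearMap.sum_apply]
  let V : Submodule ℂ (ι → ℂ) := ⨅ τ, LinearMap.ker (Φ τ)
  have hmemV : ∀ c : ι → ℂ, c ∈ V ↔ ∀ τ : ℂ ≃ₐ[K] ℂ, ∑ i : ι, τ (b i) * c i = 0 := by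
    intro c
    simp only [V, Submodule.mem_iInf, LinearMap.mem_ker, hΦ]
  -- `V` is stable under `Aut(ℂ/F)`
  have hV : ∀ ρ : ℂ ≃+* ℂ, (∀ y ∈ F, ρ y = y) → ∀ v ∈ V, (⇑ρ ∘ v) ∈ V := by
    intro ρ hρ v hv
    let ρ' : ℂ ≃ₐ[K] ℂ := { ρ with commutes' := fun k => hρ _ (hmemF.2 ⟨k, rfl⟩) }
    rw [hmemV] at hv ⊢
    intro τ
    have key : ∀ i : ι, τ (b i) = ρ ((τ.trans ρ'.symm) (b i)) := by
      intro i
      change τ (b i) = ρ' (ρ'.symm (τ (b i)))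
      rw [AlgEquiv.apply_symm_apply]
    calc ∑ i : ι, τ (b i) * (⇑ρ ∘ v) i = ∑ i : ι, ρ ((τ.trans ρ'.symm) (b i) * v i) := by
          refine Finset.sum_congr rfl fun i _ => ?_
          rw [key i, map_mul]
          rfl
      _ = ρ (∑ i : ι, (τ.trans ρ'.symm) (b i) * v i) := by rw [map_sum]
      _ = 0 := by rw [hv (τ.trans ρ'.symm), map_zero]
  have hxV : x ∈ V := (hmemV x).2 hx
  -- `K`-rational vectors of `V` are `K`-linear relations among the `bᵢ`, hence zero
  have hzero : ∀ w ∈ {w : ι → ℂ | w ∈ V ∧ ∀ i, w i ∈ F}, w = 0 := by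
    rintro w ⟨hwV, hwF⟩
    choose k hk using fun i => hmemF.1 (hwF i)
    have hrel1 : ∑ i : ι, k i • b i = 0 := by
      have h1 := (hmemV w).1 hwV AlgEquiv.refl
      simp only [AlgEquiv.coe_refl, id_eq] at h1
      rw [← h1]
      refine Finset.sum_congr rfl fun i _ => ?_
      rw [Algebra.smul_def, hk i, mul_comm]
    have hk0 := Fintype.linearIndependent_iff.1 hb k hrel1
    funext i
    rw [← hk i, hk0 i, map_zero, Pi.zero_apply]
  have hspan : Submodule.span ℂ {w : ι → ℂ | w ∈ V ∧ ∀ i, w i ∈ F} = ⊥ :=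
    Submodule.span_eq_bot.2 hzero
  have hmem := Complex.submodule_le_span_fixed_of_forall_ringEquiv F hF V hV hxV
  rw [hspan, Submodule.mem_bot] at hmem
  exact hmem

/-! ### Conjugate embeddings separate `ℂ ⊗_K ℂ` -/

/-- **The conjugates of the identity separate `ℂ ⊗_K ℂ`.** Let `ℂ` be an algebra over a countable
field `K`. If `h ∈ ℂ ⊗_K ℂ` is killed by every multiplication map `x ⊗ c ↦ τ(x) · c` with
`τ ∈ Aut_K(ℂ)` (`Algebra.TensorProduct.productMap τ id`), then `h = 0` (write `h = Σ bᵢ ⊗ cᵢ` on a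
`K`-basis `(bᵢ)` of `ℂ` and apply `Complex.eq_zero_of_forall_sum_algEquiv_mul_eq_zero`).
Equivalently: the `K`-algebra map `ℂ ⊗_K ℂ → ∏_{τ ∈ Aut_K(ℂ)} ℂ` is injective (the scheme
`Spec (ℂ ⊗_K ℂ)` has a dense set of `ℂ`-points `(τ, id)`). [folklore] -/
theorem Complex.eq_zero_of_forall_productMap_algEquiv_eq_zero {K : Type} [Field K] [Algebra K ℂ]
    (hK : #K ≤ ℵ₀) {h : ℂ ⊗[K] ℂ}
    (hh : ∀ τ : ℂ ≃ₐ[K] ℂ,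
      Algebra.TensorProduct.productMap (τ : ℂ →ₐ[K] ℂ) (AlgHom.id K ℂ) h = 0) :
    h = 0 := by
  classical
  -- a `K`-basis of `ℂ` and the coordinates of `h`
  let b := Module.Basis.ofVectorSpace K ℂ
  let e : ℂ ⊗[K] ℂ ≃ₗ[K] (Module.Basis.ofVectorSpaceIndex K ℂ →₀ ℂ) :=
    (TensorProduct.congr b.repr (LinearEquiv.refl K ℂ)).trans
      (finsuppScalarLeft K ℂ (Module.Basis.ofVectorSpaceIndex K ℂ))
  set f := e h with hf
  have hterm : ∀ i c, e.symm (Finsupp.single i c) = b i ⊗ₜ[K] c := by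
    intro i c
    change (TensorProduct.congr b.repr (LinearEquiv.refl K ℂ)).symm
      ((finsuppScalarLeft K ℂ _).symm (Finsupp.single i c)) = _
    rw [finsuppScalarLeft_symm_apply_single, TensorProduct.congr_symm_tmul,
      Module.Basis.repr_symm_single_one]
    rfl
  have hsum : h = ∑ i ∈ f.support, b i ⊗ₜ[K] f i := by
    have hf' : f = ∑ i ∈ f.support, Finsupp.single i (f i) := by
      nth_rewrite 1 [← Finsupp.sum_single f]
      rfl
    calc h = e.symm f := (e.symm_apply_apply h).symm
      _ = ∑ i ∈ f.support, e.symm (Finsupp.single i (f i)) := by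
          conv_lhs => rw [hf']
          rw [map_sum]
      _ = ∑ i ∈ f.support, b i ⊗ₜ[K] f i := Finset.sum_congr rfl fun i _ => hterm i (f i)
  -- the relations `Σ τ(bᵢ) cᵢ = 0` over the support of `f`
  set ι := ↥f.support with hι
  have hrel : ∀ τ : ℂ ≃ₐ[K] ℂ, ∑ i : ι, τ (b i) * f i = 0 := by
    intro τ
    have h1 := hh τ
    rw [hsum, map_sum] at h1
    rw [Finset.sum_coe_sort f.support (fun i => τ (b i) * f i)]
    simpa only [Algebra.TensorProduct.productMap_apply_tmul, AlgEquiv.coe_toAlgHom,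
      AlgHom.coe_coe, AlgHom.id_apply] using h1
  have hli : LinearIndependent K (fun i : ι => b i) :=
    b.linearIndependent.comp (fun i : ι => (i : Module.Basis.ofVectorSpaceIndex K ℂ))
      Subtype.val_injective
  have hc₀0 : (fun i : ι => f i) = 0 :=
    Complex.eq_zero_of_forall_sum_algEquiv_mul_eq_zero hK hli hrel
  -- hence `f = 0` and `h = 0`
  have hf0 : f = 0 := by
    ext i
    by_contra hi
    have hmem : i ∈ f.support := Finsupp.mem_support_iff.2 hi
    have h1 := congrFun hc₀0 ⟨i, hmem⟩
    exact hi h1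
  rw [← e.symm_apply_apply h, ← hf, hf0, map_zero]

end Literature.FieldTheory.AlgClosed

end
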